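import Literature.Claims.NS.Qin2026
import Mathlib.Analysis.SpecialFunctions.Trigonometric.Inverse

/-!
# C160 `Qin2026` — kill kit (refuter of record ns-claims-refuter-7 g4; D-0090 NS-CLAIMS SWEEP)

Kernel refutations of typed steps of `Literature/Claims/NS/Qin2026.lean` (typist ns-claims-typist-12 g5,
p530412; text of record = census pin `census/texts/Qin2026/`, PDF page = printed page):

* `not_Step31_i` — **TOKEN** (first failing typed step in print order, ON PATH as binder `h31` of
  `claim_of_steps_full`): Lemma 3.1 (i) p.12 l.42–45 with display (13) p.12 l.32–41 is false as printed —
  the displayed circles `γ₁(θ) = (R cos θ, R sin θ, d₀)` and `γ₂(ϕ) = (d₀, R cos ϕ, R sin ϕ)` INTERSECT: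
  with `c = d₀/R = 16/10⁴`, `γ₁(arccos c) = γ₂(arcsin c) = (d₀, R√(1 − c²), d₀)`, so their distance is `0`,
  not `≥ d̄ = 16ρ₀ > 0` (witness `ρ₀ = 1`). Likewise `γ₁ ∩ γ₃ ∋ (R√(1−c²), d₀, d₀)` and
  `γ₂ ∩ γ₃ ∋ (d₀, d₀, R√(1−c²))` (`gam1_meets_gam3`, `gam2_meets_gam3`): no two of the three printed
  centerlines are disjoint, let alone linked.
* `not_Step31_i_asProved` — the proof sentence of Lemma 3.1 (i) p.12 l.49–52 («α ≥ 8 and R ≫ ρ₀») fails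
  for the displayed circles at every radius `R ≥ d₀`: enlarging `R` never separates them.
* `not_Step58_2` — Thm 5.8 proof Step 2 p.21 l.33–47 at the real grain: the displayed inequality runs the
  wrong way (`E = 2E₀` gives `4 ≤ 1`).
* `not_Step79` — Thm 7.9 (54) p.26 l.85 – p.27 l.6 with exactly its declared inputs: the upper bound fails
  for small `E_η` (`E_η = 1/100` gives `100 ≤ 32`).
* `not_Step82_59` — Cor 8.2 (59) p.28 l.15–26 as used (Riccati on the WINDOW `{E_η ≤ 2E_η(0)}` ⇒ blow-up):
  the smooth bounded profile `y(t) = 3 − 2e^{−4t}` has `y(0) = 1`, `y′ = 8e^{−4t} ≥ y²` wherever `y ≤ 2`,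
  and `y ≤ 3` for all time.

Classification (cell grammar): false lemma (countermodel) ×5. Axioms: `propext`, `Classical.choice`,
`Quot.sound` only. WHAT THIS IS NOT: not a claim about NS regularity or blow-up; not a claim about any
author beyond the typed locator.
-/

set_option linter.dupNamespace false

noncomputable section

open Real Set

namespace Summit.NavierStokesRegularity.NavierStokesRegularity.Theorems.Qin2026

open Literature.Claims.NS.Qin2026

/-! ## Lemma 3.1 (i): the printed centerlines intersect -/

/-- `γ₁(arccos c) = γ₂(arcsin c)` for `c = d/R ∈ [−1,1]`, `R ≠ 0`: the common point `(d, R√(1−c²), d)`.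
[cite: Qin2026, Construction 3.1 (13) p.12 l.32–41] -/
theorem gam1_meets_gam2 (R d : ℝ) (hR : R ≠ 0) (h1 : -1 ≤ d / R) (h2 : d / R ≤ 1) :
    gam1 R d (arccos (d / R)) = gam2 R d (arcsin (d / R)) := by
  unfold gam1 gam2
  rw [cos_arccos h1 h2, sin_arccos, sin_arcsin h1 h2, cos_arcsin, mul_div_cancel₀ _ hR]

/-- `γ₁(arcsin c) = γ₃(arccos c)`: the common point `(R√(1−c²), d, d)`.
[cite: Qin2026, Construction 3.1 (13) p.12 l.32–41] -/
theorem gam1_meets_gam3 (R d : ℝ) (hR : R ≠ 0) (h1 : -1 ≤ d / R) (h2 : d / R ≤ 1) :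
    gam1 R d (arcsin (d / R)) = gam3 R d (arccos (d / R)) := by
  unfold gam1 gam3
  rw [cos_arccos h1 h2, sin_arccos, sin_arcsin h1 h2, cos_arcsin, mul_div_cancel₀ _ hR]

/-- `γ₂(arccos c) = γ₃(arcsin c)`: the common point `(d, d, R√(1−c²))`.
[cite: Qin2026, Construction 3.1 (13) p.12 l.32–41] -/
theorem gam2_meets_gam3 (R d : ℝ) (hR : R ≠ 0) (h1 : -1 ≤ d / R) (h2 : d / R ≤ 1) :
    gam2 R d (arccos (d / R)) = gam3 R d (arcsin (d / R)) := by
  unfold gam2 gam3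
  rw [cos_arccos h1 h2, sin_arccos, sin_arcsin h1 h2, cos_arcsin, mul_div_cancel₀ _ hR]

/-- The printed ratio `d₀/R = 16/10⁴` lies in `[−1,1]` and `R = 10⁴ρ₀ ≠ 0` for `ρ₀ ≠ 0`.
[cite: Qin2026, Def 3.7 p.14 l.2–11] -/
theorem d0_div_Rof (ρ₀ : ℝ) (hρ : ρ₀ ≠ 0) : d0 ρ₀ / Rof ρ₀ = 16 / 10 ^ 4 := by
  unfold d0 Rof alpha
  exact mul_div_mul_right _ _ hρ

/-- **Refutes `Step31_i`** [refuted-substantive] (Lemma 3.1 (i) p.12 l.42–45 at the printed parameters of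
(13)/Def 3.7): at `ρ₀ = 1` the circles `γ₁`, `γ₂` of display (13) meet at `θ = arccos(16/10⁴)`,
`ϕ = arcsin(16/10⁴)`, so `dist = 0 < 16 = d̄`. No cheap repair inside the display: every pair of the three
printed circles intersects (`gam1_meets_gam3`, `gam2_meets_gam3`), for EVERY `0 < d₀ ≤ R` — the offset
pattern of (13) puts each circle through a point of the next; a repaired statement needs different
centerlines (the author's un-displayed «suitably chosen fibers», typed as `Step31_charitable`), which this
witness does not address. [cite: Qin2026, Lemma 3.1 (i) p.12 l.42–52; (13) p.12 l.32–41] -/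
theorem not_Step31_i : ¬ Literature.Claims.NS.Qin2026.Step31_i := by
  intro h
  have hc1 : -1 ≤ d0 1 / Rof 1 := by rw [d0_div_Rof 1 one_ne_zero]; norm_num
  have hc2 : d0 1 / Rof 1 ≤ 1 := by rw [d0_div_Rof 1 one_ne_zero]; norm_num
  have hR : Rof 1 ≠ 0 := by unfold Rof; norm_num
  have h16 := (h 1 one_pos (arccos (d0 1 / Rof 1)) (arcsin (d0 1 / Rof 1))).1
  rw [gam1_meets_gam2 (Rof 1) (d0 1) hR hc1 hc2, dist_self] at h16
  have : (0 : ℝ) < d0 1 := by unfold d0 alpha; norm_num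
  linarith

/-- The same kill for EVERY core radius `ρ₀ > 0` (the statement is scale-free).
[cite: Qin2026, Lemma 3.1 (i) p.12 l.42–52] -/
theorem step31_i_fails_at (ρ₀ : ℝ) (hρ : 0 < ρ₀) :
    ¬ ∀ θ φ : ℝ, d0 ρ₀ ≤ dist (gam1 (Rof ρ₀) (d0 ρ₀) θ) (gam2 (Rof ρ₀) (d0 ρ₀) φ) := by
  intro h
  have hc1 : -1 ≤ d0 ρ₀ / Rof ρ₀ := by rw [d0_div_Rof ρ₀ hρ.ne']; norm_num
  have hc2 : d0 ρ₀ / Rof ρ₀ ≤ 1 := by rw [d0_div_Rof ρ₀ hρ.ne']; norm_num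
  have hR : Rof ρ₀ ≠ 0 := by unfold Rof; positivity
  have h16 := h (arccos (d0 ρ₀ / Rof ρ₀)) (arcsin (d0 ρ₀ / Rof ρ₀))
  rw [gam1_meets_gam2 (Rof ρ₀) (d0 ρ₀) hR hc1 hc2, dist_self] at h16
  have : (0 : ℝ) < d0 ρ₀ := by unfold d0 alpha; positivity
  linarith

/-- **Refutes `Step31_i_asProved`** — the printed PROOF SENTENCE of Lemma 3.1 (i) (p.12 l.49–52 «Minimizing
over θ, ϕ … yields a strictly positive lower bound when d₀ = αρ₀ with α ≥ 8 and R ≫ ρ₀») is false for the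
displayed circles at EVERY large radius: with `a = 8`, `ρ₀ = 1`, any `R ≥ max R₁ 8` has `d₀/R ∈ (0,1]`, so
`γ₁(arccos(d₀/R)) = γ₂(arcsin(d₀/R))` and no `δ > 0` bounds the distance below — taking `R` large does not
separate the circles of (13). [cite: Qin2026, Lemma 3.1 proof (i) p.12 l.49–52] -/
theorem not_Step31_i_asProved : ¬ Literature.Claims.NS.Qin2026.Step31_i_asProved := by
  intro h
  obtain ⟨R₁, hR₁⟩ := h 8 1 (by norm_num) one_pos
  obtain ⟨δ, hδ, hd⟩ := hR₁ (max R₁ 8) (le_max_left _ _)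
  have hR8 : (8 : ℝ) ≤ max R₁ 8 := le_max_right _ _
  have hR : max R₁ 8 ≠ 0 := by positivity
  have hc1 : -1 ≤ 8 * 1 / max R₁ 8 := by
    have : 0 ≤ 8 * 1 / max R₁ 8 := by positivity
    linarith
  have hc2 : 8 * 1 / max R₁ 8 ≤ 1 := by
    rw [div_le_one (by positivity)]; linarith
  have h0 := hd (arccos (8 * 1 / max R₁ 8)) (arcsin (8 * 1 / max R₁ 8))
  rw [gam1_meets_gam2 (max R₁ 8) (8 * 1) hR hc1 hc2, dist_self] at h0
  linarith

/-! ## Thm 5.8 proof Step 2 (p.21): the display runs the wrong way -/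

/-- **Refutes `Step58_2`** [refuted-substantive] (Thm 5.8 proof Step 2 p.21 l.33–47 at the real grain):
`C_E = N = Γ₀ = L₀ = ρ₀ = E₀ = 1`, `E = 2` satisfy `ρ₀² = C_E NΓ₀²L₀/E₀` and `E ≤ 2E₀`, and the displayed
conclusion reads `4 ≤ 1`. (From the window's LOWER bound on `ρ₀²` only an UPPER bound on `ρ₀⁻⁴` follows;
the true substitution gives `ρ₀⁻⁴ ≥ E²/(4C_E²N²Γ₀⁴L₀²)`, a factor 4 the display lacks — as typed, false.)
[cite: Qin2026, Thm 5.8 proof Step 2 p.21 l.33–47] -/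
theorem not_Step58_2 : ¬ Literature.Claims.NS.Qin2026.Step58_2 := by
  intro h
  have := h 1 1 1 1 1 1 2 one_pos one_pos one_pos one_pos one_pos one_pos two_pos (by norm_num)
    (by norm_num)
  norm_num at this

/-! ## Thm 7.9 (54) (p.26–27) with exactly its declared inputs -/

/-- **Refutes `Step79`** [refuted-substantive] (Thm 7.9 (54) p.26 l.85 – p.27 l.6, inputs = (50), (51) and
the window `E_η ≤ 2E_η(0)` only): `Γ₀ = L₀ = E_η(0) = Γ = L = 1`, `E_η = 1/100` meet every declared input and
give `Γ²L/E_η = 100 > 32·Γ₀²L₀/E_η(0)`; the printed upper-bound line silently uses `E_η ≥ E_η(0)/2` (the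
face WITH it, `Step79_withLower`, is true). [cite: Qin2026, Thm 7.9 (54) p.26 l.85 – p.27 l.6] -/
theorem not_Step79 : ¬ Literature.Claims.NS.Qin2026.Step79 := by
  intro h
  have := (h 1 1 1 1 1 (1 / 100) one_pos one_pos one_pos one_pos one_pos (by norm_num) (by norm_num)
    (by norm_num) (by norm_num) (by norm_num) (by norm_num)).2
  norm_num at this

/-! ## Cor 8.2 (59) as used (p.28): Riccati on the window does not blow up -/

/-- The bounded profile `y(t) = 3 − 2e^{−4t}`. [cite: Qin2026, Cor 8.2 p.28 l.2–26] -/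
def yb (t : ℝ) : ℝ := 3 - 2 * exp (-4 * t)

/-- `y′(t) = 8e^{−4t}`. [cite: Qin2026, Cor 8.2 p.28 l.2–26] -/
theorem hasDerivAt_yb (t : ℝ) : HasDerivAt yb (8 * exp (-4 * t)) t := by
  have h : HasDerivAt (fun s => -4 * s) (-4) t := by simpa using (hasDerivAt_id t).const_mul (-4)
  exact ((h.exp.const_mul 2).const_sub 3).congr_deriv (by ring)

/-- `y` is continuous. [cite: Qin2026, Cor 8.2 p.28 l.2–26] -/
theorem continuous_yb : Continuous yb := by unfold yb; fun_prop

/-- `y(0) = 1`. [cite: Qin2026, Cor 8.2 p.28 l.2–26] -/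
theorem yb_zero : yb 0 = 1 := by simp [yb]; norm_num

/-- `y ≤ 3` for all time — no blow-up. [cite: Qin2026, Cor 8.2 (59) p.28 l.15–26] -/
theorem yb_le_three (t : ℝ) : yb t ≤ 3 := by
  unfold yb; nlinarith [exp_pos (-4 * t)]

/-- `y ≥ 1` on `t ≥ 0`. [cite: Qin2026, Cor 8.2 p.28 l.2–26] -/
theorem one_le_yb {t : ℝ} (ht : 0 ≤ t) : 1 ≤ yb t := by
  unfold yb
  have : exp (-4 * t) ≤ 1 := by rw [exp_le_one_iff]; linarith
  linarith

/-- On the window `y ≤ 2` the Riccati inequality `y² ≤ y′ = 8e^{−4t}` holds (there `2e^{−4t} ≥ 1`).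
[cite: Qin2026, Thm 8.1 (57) p.27; Cor 8.2 p.28] -/
theorem riccati_yb {t : ℝ} (ht : 0 ≤ t) (hw : yb t ≤ 2) : 1 * yb t ^ 2 ≤ 8 * exp (-4 * t) := by
  have h1 := one_le_yb ht
  have hwin : 1 ≤ 2 * exp (-4 * t) := by unfold yb at hw; linarith
  have hsq : yb t ^ 2 ≤ 2 ^ 2 := pow_le_pow_left₀ (by linarith) hw 2
  linarith

/-- **Refutes `Step82_59`** [refuted-substantive] (Cor 8.2 (59) p.28 l.15–26 with (57) available on the
blow-up WINDOW of Thm 7.9 p.26 l.87–90, as the proof summary p.32 uses it): `C = 1`, `y(t) = 3 − 2e^{−4t}`,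
`D = y′ = 8e^{−4t}`: `y` is continuous, `y(0) = 1`, `y ≥ 1 ≥ 0` on `t ≥ 0`, `y′ ≥ y²` whenever `y ≤ 2y(0)`
(in particular whenever the window condition `∀ s ≤ t, y(s) ≤ 2y(0)` holds), yet `y ≤ 3` on
`[0, 1/(C y(0))) = [0,1)` — no blow-up. No cheap repair: on the window `y ≤ 2y(0)` by definition, so (57)
there can never force unboundedness; the printed passage needs (57) BEYOND the window, which §§5–7 do not
supply (circularity recorded in LOCATORS §3). [cite: Qin2026, Cor 8.2 (59) p.28 l.15–26; Thm 7.9 p.26 l.87–90] -/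
theorem not_Step82_59 : ¬ Literature.Claims.NS.Qin2026.Step82_59 := by
  intro h
  have hmain := h 1 yb (fun t => 8 * exp (-4 * t)) one_pos continuous_yb.continuousOn
    (by rw [yb_zero]; exact one_pos) (fun t ht => by linarith [one_le_yb ht])
    (fun t ht hw => ⟨(hasDerivAt_yb t).hasDerivWithinAt,
      riccati_yb ht (by have := hw t ⟨ht, le_rfl⟩; rw [yb_zero] at this; linarith)⟩)
  exact hmain ⟨3, fun t _ => yb_le_three t⟩

end Summit.NavierStokesRegularity.NavierStokesRegularity.Theorems.Qin2026

end

-- WHAT THIS IS NOT: not a claim about NS regularity or blow-up; not a claim about any author beyond the typed locator.
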